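import Summits.CriticalPhenomena.PercolationContinuityZ3.Theorems.PercNearOneGluingNoHeavyQuantDIBStarFSE
import Summits.CriticalPhenomena.PercolationContinuityZ3.Theorems.PercNearOneGluingNoHeavyQuantStepFSE
import HarnessLib

/-!
# QUANT lane R8, Conjecture DIB\* — CONCORDANCE of the two typings of CONJECTURE FS-E: the lead's menu `RootDec.CertFS` IS the
# typer's menu `RootDec.FSMenuE`, and `StepFSEMax ⟹ StepFSE ⟹ FSE ⟹ StepLemmaFSBig ⟺ (∀ x < 1, DIBStar x)`

builds on p205010 (kernel theorem, internal audit signed; external expert review pending)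

Support file (`--supports stmt-CriticalPhenomena-4575`), QUANT lane typer seat prim-quant-stmt (gen 20), rung R8 of
`run/shared/lean/prim/quant/LADDER.md`.  Theorems only (no definitions, no sorries, standard axioms).

Conjecture FS-E (lead g17, LEAD-NOTES-G17 N33/N34, README V208) was typed twice within the same hour on 2026-08-21: by the lead as
`Quant.IndepBlob.FSE` over the menu `Quant.RootDec.CertFS a g j s z` (`…QuantDIBStarFSE`, p260917) and by the typer seat (gen 19) as
`Quant.IndepBlob.StepFSE` / `StepFSEMax` over the menu `Quant.RootDec.FSMenuE z s a g j` (`…QuantStepFSE`, p260650).  This file records that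
the two menus are the SAME predicate and orders the conjectures, so that the lane has ONE closed-form conjecture of record (`FSE`, the weakest)
and ONE tested rule (`StepFSEMax`, the strongest):

* `Quant.RootDec.certFS_of_fsMenuE`, `fsMenuE_of_certFS`, **`certFS_iff_fsMenuE : CertFS a g j s z ↔ FSMenuE z s a g j`** — item by item:
  triv = triv, ∨ = ∨, ∧ = ∧, ε = ε; menu E's β (`j+1 ≤ s ∧ z ≤ 1`) is `CertFS`'s ∧-item with the EMPTY witness set; menu E's α′ at the floor
  `max(z, 1/2)` is `CertFS`'s α′ with `z' := max(z, 1/2)`, and conversely an α′ floor `z' ≥ max(z, 1/2)` can be lowered to `max(z, 1/2)` (the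
  filter only grows, sizes are naturals).
* **`Quant.IndepBlob.fse_of_stepFSE : StepFSE → FSE`** (`FSE` has one more hypothesis — light total `≥ j+1`, the lead's narrowing by census-1's
  small-cloud theorem — and drops `0 < a k` from the conclusion) and **`fse_of_stepFSEMax : StepFSEMax → FSE`**.
* `Quant.IndepBlob.fse_ladder` — the conjunction `(StepFSEMax → StepFSE) ∧ (StepFSE → FSE) ∧ (FSE → StepLemmaFSBig) ∧
  (StepLemmaFSBig ↔ ∀ x < 1, DIBStar x)` assembled from p260650 / this file / p260917 / p260228, for citation in the lane's tables.

So: refuting `FSE` by one hard instance refutes all three closed-form conjectures; proving `StepFSEMax` (the rule the censuses test: every blob of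
maximal size and, among those, maximal gate; kit j128350/1/3/4 + j129614/6, 0 failures) proves all of them and closes T-DIB.
[this work]; the gluing rows served [cite: KozmaNitzan2024, Conjecture 3 (p. 15)]; product weights [cite: Grimmett1999, §1.3 p. 10].
-/

namespace Summit.CriticalPhenomena.PercolationContinuityZ3.Theorems

namespace Quant

namespace RootDec

open Finset

variable {κ : Type} [Fintype κ]

/-- **Menu E certifies in the lead's menu**: `FSMenuE z s a g j → CertFS a g j s z` (β ↦ the ∧-item with the empty witness set;
α′ at `max(z, 1/2)` ↦ α′ with `z' = max(z, 1/2)`; the other four items verbatim). [this work] -/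
theorem certFS_of_fsMenuE (a : κ → ℕ) (g : κ → ℝ) (j s : ℕ) (z : ℝ) (h : FSMenuE z s a g j) : CertFS a g j s z := by
  rcases h with hz0 | ⟨hs, hz1⟩ | ⟨hz1, hsize⟩ | ⟨G, hG, hz⟩ | ⟨S, hS, hz⟩ | hε
  · exact Or.inl hz0
  · refine Or.inr (Or.inr (Or.inl ⟨∅, ?_, ?_⟩))
    · simpa using hs
    · simpa using hz1
  · exact Or.inr (Or.inr (Or.inr (Or.inl
      ⟨max z (1 / 2), le_max_left _ _, le_max_right _ _, max_le hz1 (by norm_num), hsize⟩)))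
  · exact Or.inr (Or.inl ⟨G, hG, hz⟩)
  · exact Or.inr (Or.inr (Or.inl ⟨S, hS, hz⟩))
  · exact Or.inr (Or.inr (Or.inr (Or.inr hε)))

/-- **The lead's menu certifies in menu E**: `CertFS a g j s z → FSMenuE z s a g j` (an α′ floor `z' ≥ max(z, 1/2)` is lowered to
`max(z, 1/2)`: the set of blobs with gate `≥` the floor only grows; the other items verbatim, ∧ ↦ ∧ even when the witness set is empty). [this work] -/
theorem fsMenuE_of_certFS (a : κ → ℕ) (g : κ → ℝ) (j s : ℕ) (z : ℝ) (h : CertFS a g j s z) : FSMenuE z s a g j := by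
  rcases h with hz0 | ⟨G, hG, hz⟩ | ⟨S, hS, hz⟩ | ⟨z', hzz', hhalf, h1, hsize⟩ | hε
  · exact Or.inl hz0
  · exact Or.inr (Or.inr (Or.inr (Or.inl ⟨G, hG, hz⟩)))
  · exact Or.inr (Or.inr (Or.inr (Or.inr (Or.inl ⟨S, hS, hz⟩))))
  · refine Or.inr (Or.inr (Or.inl ⟨hzz'.trans h1, hsize.trans ?_⟩))
    refine Finset.sum_le_sum_of_subset_of_nonneg (fun k hk => ?_) (fun _ _ _ => Nat.zero_le _)
    exact Finset.mem_filter.2 ⟨Finset.mem_univ _, (max_le hzz' hhalf).trans (Finset.mem_filter.1 hk).2⟩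
  · exact Or.inr (Or.inr (Or.inr (Or.inr (Or.inr hε))))

/-- **CONCORDANCE OF THE MENUS**: `CertFS a g j s z ↔ FSMenuE z s a g j` — the lead's closed-form certificate menu (p260917) and the
typer's menu E (p260650) are the same predicate. [this work] -/
theorem certFS_iff_fsMenuE (a : κ → ℕ) (g : κ → ℝ) (j s : ℕ) (z : ℝ) : CertFS a g j s z ↔ FSMenuE z s a g j :=
  ⟨fsMenuE_of_certFS a g j s z, certFS_of_fsMenuE a g j s z⟩

variable [DecidableEq κ]

/-- Soundness of menu E re-derived through the lead's `term_ge_of_certFS` (a consistency check of the concordance; the direct proof is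
`term_ge_of_fsMenuE`). [this work] -/
theorem term_ge_of_fsMenuE' (z : ℝ) (s : ℕ) (a : κ → ℕ) (g : κ → ℝ) (j : ℕ) (hg : ∀ k, 0 ≤ g k ∧ g k ≤ 1)
    (hmenu : FSMenuE z s a g j) :
    z ≤ ∑ W : Finset κ, (∏ k, if k ∈ W then g k else 1 - g k) * (if j + 1 ≤ s + ∑ k ∈ W, a k then (1 : ℝ) else 0) :=
  term_ge_of_certFS a g j s z hg (certFS_of_fsMenuE a g j s z hmenu)

end RootDec

namespace IndepBlob

open Finset

/-- **`StepFSE ⟹ FSE`**: the typer's existential FS-E (any hard-corner instance, some NON-EMPTY blob, menu E on both branches) implies the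
lead's `FSE` (hard-corner instances with light total `≥ j+1`, some blob, `CertFS` on both branches) — the extra hypothesis is discarded and the
certificates are translated by `certFS_of_fsMenuE`. [this work] -/
theorem fse_of_stepFSE (H : StepFSE) : FSE := by
  intro κ _ _ a g j x hx hx1 hg hlight hcorner hnogiant htwo _ hcredit
  obtain ⟨k, z₁, z₀, _, hconv, h₁, h₀⟩ := H κ a g j x hx hx1 hg hlight hcorner hnogiant htwo hcredit
  exact ⟨k, z₁, z₀, hconv, RootDec.certFS_of_fsMenuE _ g j _ z₁ h₁, RootDec.certFS_of_fsMenuE _ g j _ z₀ h₀⟩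

/-- **`StepFSEMax ⟹ FSE`**: the lead's fixed rule (every blob of maximal size and, among those, maximal gate — the statement the exact
censuses test) implies the conjecture of record. [this work] -/
theorem fse_of_stepFSEMax (H : StepFSEMax) : FSE :=
  fse_of_stepFSE (stepFSE_of_max H)

/-- **THE FS-E LADDER** (for the lane's tables): `StepFSEMax → StepFSE`, `StepFSE → FSE`, `FSE → StepLemmaFSBig`, and
`StepLemmaFSBig ↔ ∀ x < 1, DIBStar x` (p260650, this file, p260917, p260228).  The first three are closed-form ∀∃ statements refutable by
ONE hard instance each; the last is T-DIB itself. [this work] -/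
theorem fse_ladder :
    (StepFSEMax → StepFSE) ∧ (StepFSE → FSE) ∧ (FSE → StepLemmaFSBig) ∧ (StepLemmaFSBig ↔ ∀ x : ℝ, x < 1 → DIBStar x) :=
  ⟨stepFSE_of_max, fse_of_stepFSE, stepLemmaFSBig_of_fse, stepLemmaFSBig_iff_dibStar⟩

end IndepBlob

end Quant

end Summit.CriticalPhenomena.PercolationContinuityZ3.Theorems
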